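import Mathlib.MeasureTheory.Integral.Marginal
import Mathlib.MeasureTheory.Constructions.Pi
import Mathlib.MeasureTheory.Function.L2Space
import Mathlib.Probability.Moments.Variance
import Mathlib.Analysis.Complex.Norm
import Mathlib.MeasureTheory.Function.SpecialFunctions.Basic
import Literature.Probability.Moments.EfronSteinProofs
import HarnessLib

/-!
# Route `BECHeatBathGap`, support item `IdealGasTensorisation` (stmt-AtomisticToContinuum-14374):
# product-measure toolkit — Efron–Stein in Steele's form as an `ℝ≥0∞` inequality

Helper file for the ideal-gas rung of route `BECHeatBathGap` (lands `--supports
stmt-AtomisticToContinuum-14374`; used by `BECHeatBathGapIdealGasTensorisation.lean`). The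
approximate-tensorisation (AT) clause of that item is, for a product state, the Efron–Stein
inequality for a product probability law. The tree holds the Efron–Stein inequality in the
"independent copy" form of Boucheron–Bousquet–Lugosi 2004, §2 Theorem 5
(`Literature.Probability.Moments.EfronSteinInequality`, discharged by
`Literature.Probability.Moments.EfronSteinInequality_holds`):
`Var f ≤ ½ Σᵢ E[(f(X) − f(X with Xᵢ resampled))²]`. This file derives from it the form the item
needs:

* `lintegral_lintegral_update` — resampling one coordinate from its own law preserves the product
  law: `∫ (∫ φ(x with xᵢ := y) dμᵢ(y)) dπ(x) = ∫ φ dπ` (via Mathlib's marginal integrals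
  `MeasureTheory.lmarginal`);
* `lintegral_fin_prod_eq_prod`, `pi_withDensity_eq` — Tonelli for `∏ᵢ fᵢ(xᵢ)` on a finite
  product and `⨂ᵢ (ν.withDensity ρ) = (⨂ᵢ ν).withDensity (∏ᵢ ρ(xᵢ))` (the Born law of a tensor
  power is the power of the one-body Born law);
* `lintegral_sq_sub_integral_le` — **Steele's form** (BBL04 §2 Theorem 6, up to the constant):
  `E[(f − E f)²] ≤ 2 Σᵢ E[(f − hᵢ)²]` for arbitrary measurable predictors `hᵢ` not depending on the
  `i`-th coordinate, as an inequality of lower Lebesgue integrals (constant `2` instead of the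
  sharp `1`: the resampling term is bounded by `(a − b)² ≤ 2(a − c)² + 2(b − c)²` instead of the
  conditional-variance identity);
* `exists_lintegral_nnnorm_sub_sq_le` — the same for complex observables (real and imaginary
  parts), in the `∃ c, ∫ |F − c|² ≤ 2 Σᵢ ∫ |F − gᵢ|²` form of the route's AT clause.

No new definitions; `[folklore]` / BBL04.

## References

* S. Boucheron, O. Bousquet, G. Lugosi, *Concentration Inequalities*, in: Advanced Lectures on
  Machine Learning, LNCS 3176, Springer 2004, §2 Theorems 5–6 [BoucheronBousquetLugosi2004].
* B. Efron, C. Stein, Ann. Statist. 9 (1981) 586–596 [EfronStein1981]; J. M. Steele, Ann.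
  Statist. 14 (1986) 753–758 [Steele1986].
-/

noncomputable section

open MeasureTheory ProbabilityTheory Function

open scoped ENNReal NNReal

namespace Summit.AtomisticToContinuum.BoseEinsteinCondensation.Theorems.IdealGasTensorisation

universe u v

/-! ### Resampling one coordinate -/

/-- **Resampling one coordinate preserves a product probability law**: for the product
`π = ⨂ᵢ μᵢ` of probability measures and measurable `φ ≥ 0`,
`∫ (∫ φ(x with xᵢ := y) dμᵢ(y)) dπ(x) = ∫ φ dπ` (the `{i}`-marginal of the `{i}`-marginal is the
`{i}`-marginal). [folklore] -/
theorem lintegral_lintegral_update {δ : Type*} [Fintype δ] [DecidableEq δ] {X : δ → Type*}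
    [∀ i, MeasurableSpace (X i)] (μ : ∀ i, Measure (X i)) [∀ i, IsProbabilityMeasure (μ i)]
    {φ : (∀ i, X i) → ℝ≥0∞} (hφ : Measurable φ) (i : δ) :
    ∫⁻ x, ∫⁻ y, φ (update x i y) ∂μ i ∂Measure.pi μ = ∫⁻ x, φ x ∂Measure.pi μ := by
  have h1 : (fun x => ∫⁻ y, φ (update x i y) ∂μ i) = ∫⋯∫⁻_{i}, φ ∂μ :=
    (lmarginal_singleton φ i).symm
  rw [h1]
  refine lintegral_eq_of_lmarginal_eq {i} (hφ.lmarginal μ) hφ ?_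
  funext x
  simp only [lmarginal_singleton, update_idem, lintegral_const, measure_univ, mul_one]

/-! ### Product densities -/

/-- **Tonelli for a product of one-coordinate functions** on a finite product of `σ`-finite
measures: `∫ ∏ᵢ fᵢ(xᵢ) d(⨂ᵢ κᵢ) = ∏ᵢ ∫ fᵢ dκᵢ`. [folklore] -/
theorem lintegral_fin_prod_eq_prod : ∀ {n : ℕ} {α : Type*} [MeasurableSpace α]
    (κ : Fin n → Measure α) [∀ i, SigmaFinite (κ i)] {f : Fin n → α → ℝ≥0∞}
    (_hf : ∀ i, Measurable (f i)),
    ∫⁻ x, ∏ i, f i (x i) ∂Measure.pi κ = ∏ i, ∫⁻ y, f i y ∂κ i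
  | 0, α, _, κ, _, f, _ => by
      simp [lintegral_const, Measure.pi_empty_univ]
  | n + 1, α, _, κ, _, f, hf => by
      have hmp := measurePreserving_piFinSuccAbove (α := fun _ : Fin (n + 1) => α) κ 0
      have hmeas : Measurable fun r : Fin n → α => ∏ j, f (Fin.succAbove 0 j) (r j) :=
        Finset.measurable_prod _ fun j _ => (hf _).comp (measurable_pi_apply j)
      calc ∫⁻ x, ∏ i, f i (x i) ∂Measure.pi κ
          = ∫⁻ x, (fun p : α × (Fin n → α) => f 0 p.1 * ∏ j, f (Fin.succAbove 0 j) (p.2 j))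
              (MeasurableEquiv.piFinSuccAbove (fun _ : Fin (n + 1) => α) 0 x) ∂Measure.pi κ := by
            refine lintegral_congr fun x => ?_
            rw [Fin.prod_univ_succAbove _ 0]
            rfl
        _ = ∫⁻ p, f 0 p.1 * ∏ j, f (Fin.succAbove 0 j) (p.2 j)
              ∂(κ 0).prod (Measure.pi fun j => κ (Fin.succAbove 0 j)) :=
            (MeasurePreserving.lintegral_map_equiv
              (fun p : α × (Fin n → α) => f 0 p.1 * ∏ j, f (Fin.succAbove 0 j) (p.2 j)) _ hmp).symm
        _ = (∫⁻ y, f 0 y ∂κ 0) *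
              ∫⁻ r, ∏ j, f (Fin.succAbove 0 j) (r j) ∂Measure.pi fun j => κ (Fin.succAbove 0 j) :=
            lintegral_prod_mul (hf 0).aemeasurable hmeas.aemeasurable
        _ = (∫⁻ y, f 0 y ∂κ 0) * ∏ j, ∫⁻ y, f (Fin.succAbove 0 j) y ∂κ (Fin.succAbove 0 j) := by
            rw [lintegral_fin_prod_eq_prod (fun j => κ (Fin.succAbove 0 j)) fun j => hf _]
        _ = ∏ i, ∫⁻ y, f i y ∂κ i := (Fin.prod_univ_succAbove (fun i => ∫⁻ y, f i y ∂κ i) 0).symm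

/-- **The Born law of a tensor power is the power of the one-body Born law**: for a `σ`-finite
`ν` and a measurable density `ρ` (with `ν.withDensity ρ` `σ`-finite),
`⨂_{i<N} (ν.withDensity ρ) = (⨂_{i<N} ν).withDensity (x ↦ ∏ᵢ ρ(xᵢ))`. [folklore] -/
theorem pi_withDensity_eq {N : ℕ} {α : Type*} [MeasurableSpace α] (ν : Measure α) [SigmaFinite ν]
    {ρ : α → ℝ≥0∞} (hρ : Measurable ρ) [SigmaFinite (ν.withDensity ρ)] :
    Measure.pi (fun _ : Fin N => ν.withDensity ρ) =
      (Measure.pi fun _ : Fin N => ν).withDensity (fun x => ∏ i, ρ (x i)) := by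
  refine Measure.pi_eq fun s hs => ?_
  rw [withDensity_apply _ (MeasurableSet.univ_pi hs), Measure.restrict_pi_pi,
    lintegral_fin_prod_eq_prod (fun i => ν.restrict (s i)) fun _ => hρ]
  exact Finset.prod_congr rfl fun i _ => (withDensity_apply ρ (hs i)).symm

/-! ### Efron–Stein in Steele's form -/

/-- The elementary bound replacing the conditional-variance identity:
`(a − b)² ≤ 2(a − c)² + 2(b − c)²`, in `ℝ≥0∞`. [folklore] -/
theorem ofReal_sq_sub_le (a b c : ℝ) :
    ENNReal.ofReal ((a - b) ^ 2) ≤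
      2 * ENNReal.ofReal ((a - c) ^ 2) + 2 * ENNReal.ofReal ((b - c) ^ 2) := by
  calc ENNReal.ofReal ((a - b) ^ 2) ≤ ENNReal.ofReal (2 * (a - c) ^ 2 + 2 * (b - c) ^ 2) :=
        ENNReal.ofReal_le_ofReal (by nlinarith [sq_nonneg (a + b - 2 * c)])
    _ = 2 * ENNReal.ofReal ((a - c) ^ 2) + 2 * ENNReal.ofReal ((b - c) ^ 2) := by
        rw [ENNReal.ofReal_add (by positivity) (by positivity), ENNReal.ofReal_mul zero_le_two,
          ENNReal.ofReal_mul zero_le_two, ENNReal.ofReal_ofNat]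

/-- **Efron–Stein in Steele's form, as an `ℝ≥0∞` inequality.** For independent coordinates
(the product `⨂ᵢ μᵢ` of probability measures over a `Fintype`), a measurable square-integrable
real `f` and arbitrary measurable `hᵢ` not depending on the `i`-th coordinate,
`E[(f − E f)²] ≤ 2 Σᵢ E[(f − hᵢ)²]`. From the vendored independent-copy form
`Var f ≤ ½ Σᵢ E[(f(X) − f(X⁽ⁱ⁾))²]` (BBL04 §2 Thm 5, `EfronSteinInequality_holds`) and
`E[(f(X) − f(X⁽ⁱ⁾))²] ≤ 2E[(f − hᵢ)²] + 2E[(f(X⁽ⁱ⁾) − hᵢ(X⁽ⁱ⁾))²] = 4E[(f − hᵢ)²]`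
(`hᵢ(X⁽ⁱ⁾) = hᵢ(X)`; resampling invariance `lintegral_lintegral_update`). BBL04 §2 Thm 6 is the
sharp version with constant `1`. [cite: BoucheronBousquetLugosi2004, §2 Thms 5–6] -/
theorem lintegral_sq_sub_integral_le {ι : Type u} [Fintype ι] [DecidableEq ι] {Ω : ι → Type v}
    [∀ i, MeasurableSpace (Ω i)] (μ : ∀ i, Measure (Ω i)) [∀ i, IsProbabilityMeasure (μ i)]
    {f : (∀ i, Ω i) → ℝ} (hf : Measurable f) (hf2 : MemLp f 2 (Measure.pi μ))
    {h : ι → (∀ i, Ω i) → ℝ} (hh : ∀ i, Measurable (h i))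
    (hupd : ∀ i x y, h i (update x i y) = h i x) :
    ∫⁻ x, ENNReal.ofReal ((f x - ∫ z, f z ∂Measure.pi μ) ^ 2) ∂Measure.pi μ ≤
      2 * ∑ i, ∫⁻ x, ENNReal.ofReal ((f x - h i x) ^ 2) ∂Measure.pi μ := by
  have hES := Literature.Probability.Moments.EfronSteinInequality_holds ι Ω μ f hf hf2
  rw [← evariance_eq_lintegral_ofReal f (Measure.pi μ), ← hf2.ofReal_variance_eq]
  refine (ENNReal.ofReal_le_ofReal hES).trans ?_
  -- `ofReal ∫ ≤ ∫⁻ ofReal` for the two (nonnegative, possibly non-integrable) integrands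
  have hout : ∀ φ : (∀ i, Ω i) → ℝ, (∀ x, 0 ≤ φ x) →
      ENNReal.ofReal (∫ x, φ x ∂Measure.pi μ) ≤ ∫⁻ x, ENNReal.ofReal (φ x) ∂Measure.pi μ := by
    intro φ hφ
    by_cases hφi : Integrable φ (Measure.pi μ)
    · rw [ofReal_integral_eq_lintegral_ofReal hφi (ae_of_all _ hφ)]
    · rw [integral_undef hφi, ENNReal.ofReal_zero]
      exact zero_le
  have hin : ∀ (i : ι) (φ : Ω i → ℝ), (∀ y, 0 ≤ φ y) →
      ENNReal.ofReal (∫ y, φ y ∂μ i) ≤ ∫⁻ y, ENNReal.ofReal (φ y) ∂μ i := by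
    intro i φ hφ
    by_cases hφi : Integrable φ (μ i)
    · rw [ofReal_integral_eq_lintegral_ofReal hφi (ae_of_all _ hφ)]
    · rw [integral_undef hφi, ENNReal.ofReal_zero]
      exact zero_le
  -- each resampling term is at most `4 E[(f - hᵢ)²]`
  have key : ∀ i, ENNReal.ofReal (∫ x, ∫ y, (f x - f (update x i y)) ^ 2 ∂μ i ∂Measure.pi μ) ≤
      2 * ∫⁻ x, ENNReal.ofReal ((f x - h i x) ^ 2) ∂Measure.pi μ +
        2 * ∫⁻ x, ENNReal.ofReal ((f x - h i x) ^ 2) ∂Measure.pi μ := by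
    intro i
    have hGm : Measurable fun x => ENNReal.ofReal ((f x - h i x) ^ 2) :=
      ENNReal.measurable_ofReal.comp ((hf.sub (hh i)).pow_const 2)
    calc ENNReal.ofReal (∫ x, ∫ y, (f x - f (update x i y)) ^ 2 ∂μ i ∂Measure.pi μ)
        ≤ ∫⁻ x, ENNReal.ofReal (∫ y, (f x - f (update x i y)) ^ 2 ∂μ i) ∂Measure.pi μ :=
          hout _ fun x => integral_nonneg fun y => sq_nonneg _
      _ ≤ ∫⁻ x, ∫⁻ y, ENNReal.ofReal ((f x - f (update x i y)) ^ 2) ∂μ i ∂Measure.pi μ :=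
          lintegral_mono fun x => hin i (fun y => (f x - f (update x i y)) ^ 2) fun y => sq_nonneg _
      _ ≤ ∫⁻ x, ∫⁻ y, (2 * ENNReal.ofReal ((f x - h i x) ^ 2) +
            2 * ENNReal.ofReal ((f (update x i y) - h i (update x i y)) ^ 2)) ∂μ i ∂Measure.pi μ := by
          refine lintegral_mono fun x => lintegral_mono fun y => ?_
          rw [hupd]
          exact ofReal_sq_sub_le _ _ _
      _ = ∫⁻ x, (2 * ENNReal.ofReal ((f x - h i x) ^ 2) +
            2 * ∫⁻ y, ENNReal.ofReal ((f (update x i y) - h i (update x i y)) ^ 2) ∂μ i)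
              ∂Measure.pi μ := by
          refine lintegral_congr fun x => ?_
          rw [lintegral_add_left measurable_const, lintegral_const, measure_univ, mul_one,
            lintegral_const_mul' _ _ ENNReal.ofNat_ne_top]
      _ = 2 * ∫⁻ x, ENNReal.ofReal ((f x - h i x) ^ 2) ∂Measure.pi μ +
            2 * ∫⁻ x, ∫⁻ y, ENNReal.ofReal ((f (update x i y) - h i (update x i y)) ^ 2) ∂μ i
              ∂Measure.pi μ := by
          rw [lintegral_add_left (hGm.const_mul 2), lintegral_const_mul' _ _ ENNReal.ofNat_ne_top,
            lintegral_const_mul' _ _ ENNReal.ofNat_ne_top]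
      _ = _ := by
          rw [lintegral_lintegral_update μ hGm i]
  -- sum over the coordinates
  have hnn : ∀ i, 0 ≤ ∫ x, ∫ y, (f x - f (update x i y)) ^ 2 ∂μ i ∂Measure.pi μ :=
    fun i => integral_nonneg fun x => integral_nonneg fun y => sq_nonneg _
  rw [ENNReal.ofReal_mul (by norm_num : (0 : ℝ) ≤ 1 / 2),
    ENNReal.ofReal_sum_of_nonneg (fun i _ => hnn i), Finset.mul_sum, Finset.mul_sum]
  refine Finset.sum_le_sum fun i _ => ?_
  calc ENNReal.ofReal (1 / 2) *
        ENNReal.ofReal (∫ x, ∫ y, (f x - f (update x i y)) ^ 2 ∂μ i ∂Measure.pi μ)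
      ≤ ENNReal.ofReal (1 / 2) * (2 * ∫⁻ x, ENNReal.ofReal ((f x - h i x) ^ 2) ∂Measure.pi μ +
          2 * ∫⁻ x, ENNReal.ofReal ((f x - h i x) ^ 2) ∂Measure.pi μ) := by
        gcongr
        exact key i
    _ = 2 * ∫⁻ x, ENNReal.ofReal ((f x - h i x) ^ 2) ∂Measure.pi μ := by
        rw [← two_mul, ← mul_assoc, one_div, ENNReal.ofReal_inv_of_pos two_pos,
          ENNReal.ofReal_ofNat, ENNReal.inv_mul_cancel (by norm_num) ENNReal.ofNat_ne_top,
          one_mul]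

/-! ### Complex observables -/

/-- `|z|² = (Re z)² + (Im z)²` in `ℝ≥0∞`. [folklore] -/
theorem coe_nnnorm_sq_eq (z : ℂ) :
    (‖z‖₊ : ℝ≥0∞) ^ 2 = ENNReal.ofReal (z.re ^ 2) + ENNReal.ofReal (z.im ^ 2) := by
  rw [← ENNReal.ofReal_add (sq_nonneg _) (sq_nonneg _), ← ENNReal.coe_pow,
    ← ENNReal.ofReal_coe_nnreal, NNReal.coe_pow, coe_nnnorm, Complex.sq_norm, Complex.normSq_apply]
  congr 1
  ring

/-- `∫ |H|² = ∫ (Re H)² + ∫ (Im H)²` for measurable complex `H`. [folklore] -/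
theorem lintegral_nnnorm_sq_eq_add {α : Type*} [MeasurableSpace α] {μ : Measure α}
    {H : α → ℂ} (hH : Measurable H) :
    ∫⁻ x, (‖H x‖₊ : ℝ≥0∞) ^ 2 ∂μ =
      ∫⁻ x, ENNReal.ofReal ((H x).re ^ 2) ∂μ + ∫⁻ x, ENNReal.ofReal ((H x).im ^ 2) ∂μ := by
  have hm : Measurable fun x => ENNReal.ofReal ((H x).re ^ 2) :=
    ENNReal.measurable_ofReal.comp ((Complex.measurable_re.comp hH).pow_const 2)
  rw [← lintegral_add_left hm]
  exact lintegral_congr fun x => coe_nnnorm_sq_eq (H x)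

/-- **Efron–Stein (Steele form) for complex observables, `∃ c` form of the route's AT clause.**
For independent coordinates (`⨂ᵢ μᵢ`, probability measures), a measurable square-integrable
complex `F` and measurable complex predictors `gᵢ` not depending on the `i`-th coordinate, there
is `c ∈ ℂ` (namely `c = E F`) with `∫ |F − c|² ≤ 2 Σᵢ ∫ |F − gᵢ|²` (real and imaginary parts of
`lintegral_sq_sub_integral_le`). [cite: BoucheronBousquetLugosi2004, §2 Thms 5–6] -/
theorem exists_lintegral_nnnorm_sub_sq_le {ι : Type u} [Fintype ι] [DecidableEq ι]
    {Ω : ι → Type v} [∀ i, MeasurableSpace (Ω i)] (μ : ∀ i, Measure (Ω i))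
    [∀ i, IsProbabilityMeasure (μ i)] {F : (∀ i, Ω i) → ℂ} (hF : Measurable F)
    (hF2 : MemLp F 2 (Measure.pi μ)) {g : ι → (∀ i, Ω i) → ℂ} (hg : ∀ i, Measurable (g i))
    (hupd : ∀ i x y, g i (update x i y) = g i x) :
    ∃ c : ℂ, ∫⁻ x, (‖F x - c‖₊ : ℝ≥0∞) ^ 2 ∂Measure.pi μ ≤
      2 * ∑ i, ∫⁻ x, (‖F x - g i x‖₊ : ℝ≥0∞) ^ 2 ∂Measure.pi μ := by
  have hre : MemLp (fun x => (F x).re) 2 (Measure.pi μ) :=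
    hF2.of_le (Complex.measurable_re.comp hF).aestronglyMeasurable
      (ae_of_all _ fun x => by
        rw [Real.norm_eq_abs]
        exact Complex.abs_re_le_norm _)
  have him : MemLp (fun x => (F x).im) 2 (Measure.pi μ) :=
    hF2.of_le (Complex.measurable_im.comp hF).aestronglyMeasurable
      (ae_of_all _ fun x => by
        rw [Real.norm_eq_abs]
        exact Complex.abs_im_le_norm _)
  have h1 := lintegral_sq_sub_integral_le μ (f := fun x => (F x).re) (Complex.measurable_re.comp hF) hre
    (h := fun i x => (g i x).re) (fun i => Complex.measurable_re.comp (hg i))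
    (fun i x y => by simp only [hupd])
  have h2 := lintegral_sq_sub_integral_le μ (f := fun x => (F x).im) (Complex.measurable_im.comp hF) him
    (h := fun i x => (g i x).im) (fun i => Complex.measurable_im.comp (hg i))
    (fun i x y => by simp only [hupd])
  refine ⟨⟨∫ z, (F z).re ∂Measure.pi μ, ∫ z, (F z).im ∂Measure.pi μ⟩, ?_⟩
  calc ∫⁻ x, (‖F x - ⟨∫ z, (F z).re ∂Measure.pi μ, ∫ z, (F z).im ∂Measure.pi μ⟩‖₊ : ℝ≥0∞) ^ 2
        ∂Measure.pi μ
      = ∫⁻ x, ENNReal.ofReal (((F x).re - ∫ z, (F z).re ∂Measure.pi μ) ^ 2) ∂Measure.pi μ +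
          ∫⁻ x, ENNReal.ofReal (((F x).im - ∫ z, (F z).im ∂Measure.pi μ) ^ 2) ∂Measure.pi μ := by
        rw [lintegral_nnnorm_sq_eq_add (H := fun x => F x - _) (hF.sub measurable_const)]
        simp only [Complex.sub_re, Complex.sub_im]
    _ ≤ 2 * ∑ i, ∫⁻ x, ENNReal.ofReal (((F x).re - (g i x).re) ^ 2) ∂Measure.pi μ +
          2 * ∑ i, ∫⁻ x, ENNReal.ofReal (((F x).im - (g i x).im) ^ 2) ∂Measure.pi μ :=
        add_le_add h1 h2
    _ = 2 * ∑ i, ∫⁻ x, (‖F x - g i x‖₊ : ℝ≥0∞) ^ 2 ∂Measure.pi μ := by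
        rw [← mul_add, ← Finset.sum_add_distrib]
        congr 1
        refine Finset.sum_congr rfl fun i _ => ?_
        rw [lintegral_nnnorm_sq_eq_add (H := fun x => F x - g i x) (hF.sub (hg i))]
        simp only [Complex.sub_re, Complex.sub_im]

end Summit.AtomisticToContinuum.BoseEinsteinCondensation.Theorems.IdealGasTensorisation

end
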